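import Summits.NavierStokesRegularity.OSWSelfSimilar.SheetRPerturbedPair
import Literature.Analysis.OperatorTheory.PseudoResolvent
import HarnessLib

/-!
# SHEET-ℝ frame, (P1) for the FULL operator `A = (−∂² + d∂ + V) + K` under a Gårding datum with a GENERAL `‖v₁‖²_w`-coefficient
# `c > 0`: the complex resolvent `R_K(σ) : L²_w(ℂ) →L[ℂ] L²_w(ℂ)` on `Re σ > −m` (closes the typed-interface gap (g1) for cert-1's (S1))

HONEST FRAMING (cell ns-blowup GROUP B / zone Z3, case Z3-SR-SPEC, PAPER item (P1) «`(A_F + σJ)⁻¹J` exists as a bounded operator on `L²_w`,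
analytic on `Re σ > −(c₁ + γ)`» of SHEET-R-SPEC-PRICE-impl1 (S3); 1-D MODEL certificate frame (viscous gCLM/OSW sheet on the line); not Euler/NS;
«violates: none — MODEL»). Nothing here asserts that a profile exists; `K : Esp L hL →L[ℝ] W L` is an arbitrary bounded real operator
(cert-1: `K = −P + F`) and the Gårding datum of the PERTURBED form is the HYPOTHESIS, bundled in `GardingDataKC`.

WHY THIS FILE (profile-refuter g5, STATUS l.7964, gap (g1)): `SheetRPerturbedPair.GardingDataK` fixes the `‖v₁‖²_w`-coefficient of the Gårding
bound at `1`, while the (S1) sentence of record reads `c₂‖δ′‖²_w + (c₁ + γ)‖δ‖²_w ≤ ⟨A_F δ, wδ⟩` with `c₂ = 1/5`; the coefficient cannot be upgraded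
(the `K`-terms pair with `v`, not `v₁`).  Here the datum is `c·‖v₁‖²_w + m‖v‖²_w ≤ linForm(v; v) + ∫ w K(jmap v)·v` with ANY `c > 0`
(`GardingDataKC`, field `c_pos`; `GardingDataK.toKC` embeds the old structure at `c = 1`), the coercivity constant becomes
`κ_c(s) = min(c, 4(m + s))`, and the whole chain of `SheetRPerturbedResolvent` is re-derived verbatim on it (the tree's files are append-only,
so this is an additive parallel chain; the `K`-generic Lions step `exists_pairSolutionOperatorK`, the perturbed uniqueness
`pair_eq_zero_of_weakK` and the complex pivot packaging are REUSED, not copied):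
`shift_hypsKC`, `kappaC_pos`, `coerciveKC_shift`; `pairOpKC` (choice) / `pairOpKC_spec` / `pairOpKC_unique` / `pairOpKC_rot`;
`resolventRKC`, **`resolventKC σ : Wc L →L[ℂ] Wc L`** (`ℂ`-linear by the rotation lemma; `0` outside the half-plane, junk value);
`resolventKC_weak`; `norm_resolventKC_le` (`≤ 8/κ_c(σ)`).  The resolvent identity, pseudo-resolvent structure, holomorphy and the sharp pivot
bound `‖R_K(σ)G‖ ≤ ‖G‖/(m + Re σ)` (all UNCHANGED in form — the half-plane is `{Re σ > −m}` whatever `c` is) are the next file.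
Instantiation for cert-1: `c := c₂` (for `Ω*`: `c₂ − Δ`), `m := c₁ + γ` (for `Ω*`: `c₁ − 4Δ + γ`), `K := −P + F`; `κ_c(−0.03) = min(0.2, 0.48) = 0.2`.
KERNEL CAVEAT as before: tests are odd, so `R_K(σ)` is the resolvent ON THE ODD CLASS and a pseudo-resolvent on all of `L²_w(ℂ)`.
One hypothesis structure and three definitions (`pairOpKC`, `resolventRKC`, `resolventKC`); no named fact.  WHAT THIS IS NOT: not NS; not the
spectral certificate; no number of record moves.
-/

noncomputable section

namespace Summit.NavierStokesRegularity.OSWSelfSimilar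
namespace SheetRPerturbedResolventC

open _root_.MeasureTheory _root_.Set _root_.Filter _root_.Real SheetRWeakProfilePV SheetRWeakToStrong SheetREnergyClass SheetRWeightedMeasure
  SheetRLinearisedTests SheetREnergySpace SheetRTestSpace SheetRLinearisedFormBounds SheetRSolutionOperator SheetRLinearisedCutoffEnergy
  SheetRResolventPair SheetRComplexPivot SheetRResolventComplex SheetRPerturbedUniqueness SheetRPerturbedPair Literature.Analysis.OperatorTheory
open scoped Topology ENNReal

/-! ### §1 The hypothesis structure with a general `‖v₁‖²_w`-coefficient, and the shifted perturbed form -/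

/-- **Coefficient data with a Gårding bound for the PERTURBED form, general leading coefficient** `c > 0`: drift/potential of record and
`c·‖v₁‖²_w + m‖v‖²_w ≤ linForm(v; v) + ∫ w K(jmap v)·v` on every compactly supported odd energy-class test (`m ∈ ℝ` may be negative). [folklore] -/
structure GardingDataKC (L : ℝ) (hL : 0 < L) (d V : ℝ → ℝ) (K : Esp L hL →L[ℝ] W L) (D₀ D₁ V₀ c m : ℝ) : Prop where
  /-- `d` is a.e.-strongly measurable -/
  d_meas : AEStronglyMeasurable d volume
  /-- `V` is a.e.-strongly measurable -/
  V_meas : AEStronglyMeasurable V volume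
  /-- `D₀ ≥ 0` -/
  D₀_nonneg : 0 ≤ D₀
  /-- `D₁ ≥ 0` -/
  D₁_nonneg : 0 ≤ D₁
  /-- linear growth of the drift -/
  d_le : ∀ ξ, |d ξ| ≤ D₀ + D₁ * |ξ|
  /-- boundedness of the potential -/
  V_le : ∀ ξ, |V ξ| ≤ V₀
  /-- positivity of the `‖v₁‖²_w`-coefficient -/
  c_pos : 0 < c
  /-- the Gårding lower bound for the perturbed form on compactly supported tests, `‖v₁‖²_w`-coefficient `c` -/
  garding : ∀ vp : testSpace,
    c * (∫ ξ, (L ^ 2 + ξ ^ 2) * vp.1.2 ξ ^ 2) + m * ∫ ξ, (L ^ 2 + ξ ^ 2) * vp.1.1 ξ ^ 2 ≤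
      linForm L d V vp.1.1 vp.1.2 vp.1.1 vp.1.2 + ∫ y, (L ^ 2 + y ^ 2) * (((K (jmap hL vp) : W L) : ℝ → ℝ) y * vp.1.1 y)

/-- The structure of record `GardingDataK` (coefficient `1`) is the case `c = 1`. [folklore] -/
theorem _root_.Summit.NavierStokesRegularity.OSWSelfSimilar.SheetRPerturbedPair.GardingDataK.toKC {L D₀ D₁ V₀ m : ℝ} {d V : ℝ → ℝ}
    {hL : 0 < L} {K : Esp L hL →L[ℝ] W L} (h : GardingDataK L hL d V K D₀ D₁ V₀ m) : GardingDataKC L hL d V K D₀ D₁ V₀ 1 m where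
  d_meas := h.d_meas
  V_meas := h.V_meas
  D₀_nonneg := h.D₀_nonneg
  D₁_nonneg := h.D₁_nonneg
  d_le := h.d_le
  V_le := h.V_le
  c_pos := one_pos
  garding vp := by rw [one_mul]; exact h.garding vp

/-- **Monotonicity in the constants**: a datum with `(c, m)` is a datum with any `0 < c' ≤ c`, `m' ≤ m`. [folklore] -/
theorem GardingDataKC.mono {L D₀ D₁ V₀ c m c' m' : ℝ} {d V : ℝ → ℝ} {hL : 0 < L} {K : Esp L hL →L[ℝ] W L}
    (h : GardingDataKC L hL d V K D₀ D₁ V₀ c m) (hc' : 0 < c') (hcc : c' ≤ c) (hmm : m' ≤ m) : GardingDataKC L hL d V K D₀ D₁ V₀ c' m' where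
  d_meas := h.d_meas
  V_meas := h.V_meas
  D₀_nonneg := h.D₀_nonneg
  D₁_nonneg := h.D₁_nonneg
  d_le := h.d_le
  V_le := h.V_le
  c_pos := hc'
  garding vp := by
    have hG := h.garding vp
    have hn0 : 0 ≤ ∫ ξ, (L ^ 2 + ξ ^ 2) * vp.1.1 ξ ^ 2 := integral_nonneg fun y => by positivity
    have hn1 : 0 ≤ ∫ ξ, (L ^ 2 + ξ ^ 2) * vp.1.2 ξ ^ 2 := integral_nonneg fun y => by positivity
    nlinarith [mul_le_mul_of_nonneg_right hcc hn1, mul_le_mul_of_nonneg_right hmm hn0]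

variable {L D₀ D₁ V₀ c m : ℝ} {d V : ℝ → ℝ} {hL : 0 < L} {K : Esp L hL →L[ℝ] W L}

/-- The coefficient facts of the shifted potential `V + s`. [folklore] -/
theorem shift_hypsKC (h : GardingDataKC L hL d V K D₀ D₁ V₀ c m) (s : ℝ) :
    AEStronglyMeasurable (fun ξ => V ξ + s) volume ∧ ∀ ξ, |V ξ + s| ≤ V₀ + |s| :=
  ⟨h.V_meas.add aestronglyMeasurable_const, fun ξ => (abs_add_le _ _).trans (add_le_add (h.V_le ξ) le_rfl)⟩

/-- The coercivity constant of the shifted perturbed form, `κ_c(s) = min(c, 4(m + s))`, is positive for `s > −m`. [folklore] -/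
theorem kappaC_pos (h : GardingDataKC L hL d V K D₀ D₁ V₀ c m) {s : ℝ} (hs : -m < s) : 0 < min c (4 * (m + s)) :=
  lt_min h.c_pos (by linarith)

/-- **Coercivity of the shifted perturbed form on tests**: for every real `s`,
`κ_c(s)‖jmap v‖² ≤ linForm L d (V + s) v v₁ v v₁ + ∫ w K(jmap v)·v`, `κ_c(s) = min(c, 4(m + s))` (useful for `s > −m`, where `κ_c(s) > 0`). [folklore] -/
theorem coerciveKC_shift (h : GardingDataKC L hL d V K D₀ D₁ V₀ c m) (s : ℝ) (vp : testSpace) :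
    min c (4 * (m + s)) * ‖jmap hL vp‖ ^ 2 ≤
      linForm L d (fun ξ => V ξ + s) vp.1.1 vp.1.2 vp.1.1 vp.1.2
        + ∫ y, (L ^ 2 + y ^ 2) * (((K (jmap hL vp) : W L) : ℝ → ℝ) y * vp.1.1 y) := by
  obtain ⟨hc, -, -, -⟩ := basic_of_isCompactTest vp.2
  obtain ⟨hwv, hwv₁⟩ := weighted_of_isCompactTest (L := L) vp.2
  obtain ⟨hint, -⟩ := abs_linForm_le hL h.d_meas h.V_meas h.D₁_nonneg h.d_le h.V_le vp.2 hc.aestronglyMeasurable vp.2.memLp.1 hwv hwv₁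
  have hshift : linForm L d (fun ξ => V ξ + s) vp.1.1 vp.1.2 vp.1.1 vp.1.2 =
      linForm L d V vp.1.1 vp.1.2 vp.1.1 vp.1.2 + s * ∫ y, (L ^ 2 + y ^ 2) * vp.1.1 y ^ 2 := by
    unfold linForm
    rw [← integral_const_mul, ← integral_add hint (hwv.const_mul s)]
    refine integral_congr_ae (Eventually.of_forall fun y => ?_)
    ring
  rw [hshift, sq_norm_jmap]
  have hG := h.garding vp
  have hκc : min c (4 * (m + s)) ≤ c := min_le_left _ _
  have hκ4 : min c (4 * (m + s)) ≤ 4 * (m + s) := min_le_right _ _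
  have hn0 : 0 ≤ ∫ ξ, (L ^ 2 + ξ ^ 2) * vp.1.1 ξ ^ 2 := integral_nonneg fun y => by positivity
  have hn1 : 0 ≤ ∫ ξ, (L ^ 2 + ξ ^ 2) * vp.1.2 ξ ^ 2 := integral_nonneg fun y => by positivity
  nlinarith [mul_le_mul_of_nonneg_right hκc hn1, mul_le_mul_of_nonneg_right hκ4 hn0]

/-! ### §2 The perturbed pair solution operator at `σ`, and its uniqueness -/

/-- **The perturbed pair solution operator** at `σ` (`Re σ > −m`), by choice. [folklore] -/
def pairOpKC (hL : 0 < L) (K : Esp L hL →L[ℝ] W L) (h : GardingDataKC L hL d V K D₀ D₁ V₀ c m) (σ : ℂ) (hσ : -m < σ.re) :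
    WithLp 2 (W L × W L) →L[ℝ] WithLp 2 (Esp L hL × Esp L hL) :=
  Classical.choose (exists_pairSolutionOperatorK hL K h.d_meas (shift_hypsKC h σ.re).1 h.D₁_nonneg h.d_le (shift_hypsKC h σ.re).2 σ.im
    (kappaC_pos h hσ) (coerciveKC_shift h σ.re))

/-- The defining property of `pairOpKC`: the perturbed weak pair system (potential `V + Re σ`, coupling `Im σ`) and the bound
`‖pairOpKC σ G‖ ≤ (4/κ(σ))‖G‖`. [folklore] -/
theorem pairOpKC_spec (hL : 0 < L) (K : Esp L hL →L[ℝ] W L) (h : GardingDataKC L hL d V K D₀ D₁ V₀ c m) (σ : ℂ) (hσ : -m < σ.re) :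
    (∀ (G : WithLp 2 (W L × W L)) (v v₁ : ℝ → ℝ), IsCompactTest v v₁ →
        linForm L d (fun ξ => V ξ + σ.re) (prim (der (pairOpKC hL K h σ hσ G).fst)) (der (pairOpKC hL K h σ hσ G).fst) v v₁
              + (∫ y, (L ^ 2 + y ^ 2) * (((K (pairOpKC hL K h σ hσ G).fst : W L) : ℝ → ℝ) y * v y))
              - σ.im * ∫ y, (L ^ 2 + y ^ 2) * (prim (der (pairOpKC hL K h σ hσ G).snd) y * v y) =
            ∫ y, (L ^ 2 + y ^ 2) * ((G.fst : ℝ → ℝ) y * v y) ∧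
          linForm L d (fun ξ => V ξ + σ.re) (prim (der (pairOpKC hL K h σ hσ G).snd)) (der (pairOpKC hL K h σ hσ G).snd) v v₁
              + (∫ y, (L ^ 2 + y ^ 2) * (((K (pairOpKC hL K h σ hσ G).snd : W L) : ℝ → ℝ) y * v y))
              + σ.im * ∫ y, (L ^ 2 + y ^ 2) * (prim (der (pairOpKC hL K h σ hσ G).fst) y * v y) =
            ∫ y, (L ^ 2 + y ^ 2) * ((G.snd : ℝ → ℝ) y * v y)) ∧
      ∀ G : WithLp 2 (W L × W L), ‖pairOpKC hL K h σ hσ G‖ ≤ 4 / min c (4 * (m + σ.re)) * ‖G‖ :=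
  Classical.choose_spec (exists_pairSolutionOperatorK hL K h.d_meas (shift_hypsKC h σ.re).1 h.D₁_nonneg h.d_le (shift_hypsKC h σ.re).2 σ.im
    (kappaC_pos h hσ) (coerciveKC_shift h σ.re))

/-- The left-hand sides of the perturbed pair system as values of the bundled maps (`Eform`, `Pdata`, `Bcpl`). [folklore] -/
theorem lhs_eqKC (hL : 0 < L) (K : Esp L hL →L[ℝ] W L) (h : GardingDataKC L hL d V K D₀ D₁ V₀ c m) (s t : ℝ) (p q : Esp L hL)
    (v v₁ : ℝ → ℝ) (hv : IsCompactTest v v₁) :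
    linForm L d (fun ξ => V ξ + s) (prim (der p)) (der p) v v₁ + (∫ y, (L ^ 2 + y ^ 2) * (((K p : W L) : ℝ → ℝ) y * v y))
        - t * ∫ y, (L ^ 2 + y ^ 2) * (prim (der q) y * v y) =
      Eform hL h.d_meas (shift_hypsKC h s).1 h.D₁_nonneg h.d_le (shift_hypsKC h s).2 p ⟨(v, v₁), hv⟩ + Pdata hL (K p) ⟨(v, v₁), hv⟩
        - t * Bcpl hL q ⟨(v, v₁), hv⟩ := by
  rw [Eform_apply, Pdata_apply, Bcpl_apply]

/-- **Uniqueness**: an energy-space pair solving the perturbed `σ`-system weakly with data `G` IS `pairOpKC σ G`. [folklore] -/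
theorem pairOpKC_unique (hL : 0 < L) (K : Esp L hL →L[ℝ] W L) (h : GardingDataKC L hL d V K D₀ D₁ V₀ c m) (σ : ℂ) (hσ : -m < σ.re)
    (G : WithLp 2 (W L × W L)) {Q : WithLp 2 (Esp L hL × Esp L hL)}
    (hQ : ∀ v v₁ : ℝ → ℝ, IsCompactTest v v₁ →
      linForm L d (fun ξ => V ξ + σ.re) (prim (der Q.fst)) (der Q.fst) v v₁
            + (∫ y, (L ^ 2 + y ^ 2) * (((K Q.fst : W L) : ℝ → ℝ) y * v y))
            - σ.im * ∫ y, (L ^ 2 + y ^ 2) * (prim (der Q.snd) y * v y) = ∫ y, (L ^ 2 + y ^ 2) * ((G.fst : ℝ → ℝ) y * v y) ∧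
        linForm L d (fun ξ => V ξ + σ.re) (prim (der Q.snd)) (der Q.snd) v v₁
            + (∫ y, (L ^ 2 + y ^ 2) * (((K Q.snd : W L) : ℝ → ℝ) y * v y))
            + σ.im * ∫ y, (L ^ 2 + y ^ 2) * (prim (der Q.fst) y * v y) = ∫ y, (L ^ 2 + y ^ 2) * ((G.snd : ℝ → ℝ) y * v y)) :
    Q = pairOpKC hL K h σ hσ G := by
  set P := pairOpKC hL K h σ hσ G with hP
  have hPs := (pairOpKC_spec hL K h σ hσ).1 G
  obtain ⟨hVs, hVb⟩ := shift_hypsKC h σ.re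
  -- the difference solves the homogeneous perturbed pair system
  have hzero := pair_eq_zero_of_weakK hL h.d_meas hVs h.D₀_nonneg h.D₁_nonneg h.d_le hVb K (kappaC_pos h hσ) (coerciveKC_shift h σ.re) σ.im
    (pR := (Q - P).fst) (pI := (Q - P).snd) (fun v v₁ hv => ?_) (fun v v₁ hv => ?_)
  · obtain ⟨h1, h2⟩ := hzero
    rw [WithLp.sub_fst, sub_eq_zero] at h1
    rw [WithLp.sub_snd, sub_eq_zero] at h2
    exact WithLp.ofLp_injective 2 (Prod.ext h1 h2)
  · rw [lhs_eqKC hL K h σ.re σ.im _ _ v v₁ hv, WithLp.sub_fst, WithLp.sub_snd, map_sub K, LinearMap.map_sub₂, LinearMap.map_sub₂,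
      LinearMap.map_sub₂]
    have e1 := (hQ v v₁ hv).1
    have e2 := (hPs v v₁ hv).1
    rw [lhs_eqKC hL K h σ.re σ.im _ _ v v₁ hv] at e1 e2
    linarith
  · have key : ∀ (p q : Esp L hL), linForm L d (fun ξ => V ξ + σ.re) (prim (der p)) (der p) v v₁
        + (∫ y, (L ^ 2 + y ^ 2) * (((K p : W L) : ℝ → ℝ) y * v y)) + σ.im * ∫ y, (L ^ 2 + y ^ 2) * (prim (der q) y * v y) =
        Eform hL h.d_meas hVs h.D₁_nonneg h.d_le hVb p ⟨(v, v₁), hv⟩ + Pdata hL (K p) ⟨(v, v₁), hv⟩ + σ.im * Bcpl hL q ⟨(v, v₁), hv⟩ := by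
      intro p q; rw [Eform_apply, Pdata_apply, Bcpl_apply]
    rw [key, WithLp.sub_fst, WithLp.sub_snd, map_sub K, LinearMap.map_sub₂, LinearMap.map_sub₂, LinearMap.map_sub₂]
    have e1 := (hQ v v₁ hv).2
    have e2 := (hPs v v₁ hv).2
    rw [key] at e1 e2
    linarith

/-- **Rotation**: `pairOpKC σ (−g_I, g_R) = (−p_I, p_R)` — realified `ℂ`-linearity. [folklore] -/
theorem pairOpKC_rot (hL : 0 < L) (K : Esp L hL →L[ℝ] W L) (h : GardingDataKC L hL d V K D₀ D₁ V₀ c m) (σ : ℂ) (hσ : -m < σ.re)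
    (G : WithLp 2 (W L × W L)) :
    pairOpKC hL K h σ hσ (WithLp.toLp 2 (-G.snd, G.fst)) = WithLp.toLp 2 (-(pairOpKC hL K h σ hσ G).snd, (pairOpKC hL K h σ hσ G).fst) := by
  set Q := pairOpKC hL K h σ hσ G with hQdef
  have hQ := (pairOpKC_spec hL K h σ hσ).1 G
  symm
  refine pairOpKC_unique hL K h σ hσ _ fun v v₁ hv => ?_
  obtain ⟨e1, e2⟩ := hQ v v₁ hv
  have hR1 : (WithLp.toLp 2 (-Q.snd, Q.fst) : WithLp 2 (Esp L hL × Esp L hL)).fst = -Q.snd := rfl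
  have hR2 : (WithLp.toLp 2 (-Q.snd, Q.fst) : WithLp 2 (Esp L hL × Esp L hL)).snd = Q.fst := rfl
  have hD1 : (WithLp.toLp 2 (-G.snd, G.fst) : WithLp 2 (W L × W L)).fst = -G.snd := rfl
  have hD2 : (WithLp.toLp 2 (-G.snd, G.fst) : WithLp 2 (W L × W L)).snd = G.fst := rfl
  rw [hR1, hR2, hD1, hD2]
  obtain ⟨hneg_ae, hneg_prim⟩ := der_neg hL Q.snd
  have hlin : linForm L d (fun ξ => V ξ + σ.re) (prim (der (-Q.snd))) (der (-Q.snd)) v v₁ =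
      -1 * linForm L d (fun ξ => V ξ + σ.re) (prim (der Q.snd)) (der Q.snd) v v₁ := by
    rw [linForm_congr_ae L d _ (Eventually.of_forall fun y => congrFun hneg_prim y) hneg_ae]
    exact linForm_smul_left L d _ (-1)
  have hcpl : ∫ y, (L ^ 2 + y ^ 2) * (prim (der (-Q.snd)) y * v y) = -1 * ∫ y, (L ^ 2 + y ^ 2) * (prim (der Q.snd) y * v y) := by
    rw [← integral_const_mul]
    refine integral_congr_ae (Eventually.of_forall fun y => ?_)
    show (L ^ 2 + y ^ 2) * (prim (der (-Q.snd)) y * v y) = -1 * ((L ^ 2 + y ^ 2) * (prim (der Q.snd) y * v y))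
    rw [congrFun hneg_prim y]; ring
  have hdat : ∫ y, (L ^ 2 + y ^ 2) * ((((-G.snd : W L)) : ℝ → ℝ) y * v y) = -1 * ∫ y, (L ^ 2 + y ^ 2) * ((G.snd : ℝ → ℝ) y * v y) := by
    rw [← integral_const_mul]
    refine integral_congr_ae ((ae_volume_of_ae_μw hL (Lp.coeFn_neg (G.snd : W L))).mono fun y hy => ?_)
    show (L ^ 2 + y ^ 2) * (((-G.snd : W L) : ℝ → ℝ) y * v y) = -1 * ((L ^ 2 + y ^ 2) * ((G.snd : ℝ → ℝ) y * v y))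
    rw [hy, Pi.neg_apply]; ring
  have hK : ∫ y, (L ^ 2 + y ^ 2) * (((K (-Q.snd) : W L) : ℝ → ℝ) y * v y) = -1 * ∫ y, (L ^ 2 + y ^ 2) * (((K Q.snd : W L) : ℝ → ℝ) y * v y) := by
    rw [← integral_const_mul, map_neg K]
    refine integral_congr_ae ((ae_volume_of_ae_μw hL (Lp.coeFn_neg (K Q.snd : W L))).mono fun y hy => ?_)
    show (L ^ 2 + y ^ 2) * (((-(K Q.snd) : W L) : ℝ → ℝ) y * v y) = -1 * ((L ^ 2 + y ^ 2) * (((K Q.snd : W L) : ℝ → ℝ) y * v y))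
    rw [hy, Pi.neg_apply]; ring
  refine ⟨?_, ?_⟩
  · rw [hlin, hK, hdat]; linarith
  · rw [hcpl]; linarith

/-! ### §3 The perturbed resolvent on the complex pivot space -/

/-- The `ℝ`-linear perturbed resolvent (`0` outside `Re σ > −m`). [folklore] -/
def resolventRKC (hL : 0 < L) (K : Esp L hL →L[ℝ] W L) (h : GardingDataKC L hL d V K D₀ D₁ V₀ c m) (σ : ℂ) : Wc L →L[ℝ] Wc L :=
  if hσ : -m < σ.re then (ofPair L).comp ((ιpair hL).comp ((pairOpKC hL K h σ hσ).comp (toPair L))) else 0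

/-- Formula for `resolventRKC` inside the half-plane. [folklore] -/
theorem resolventRKC_apply (hL : 0 < L) (K : Esp L hL →L[ℝ] W L) (h : GardingDataKC L hL d V K D₀ D₁ V₀ c m) {σ : ℂ} (hσ : -m < σ.re)
    (G : Wc L) : resolventRKC hL K h σ G = ofPair L (ιpair hL (pairOpKC hL K h σ hσ (toPair L G))) := by
  rw [resolventRKC, dif_pos hσ]; rfl

/-- `resolventRKC σ = 0` outside the half-plane. [folklore] -/
theorem resolventRKC_of_not (hL : 0 < L) (K : Esp L hL →L[ℝ] W L) (h : GardingDataKC L hL d V K D₀ D₁ V₀ c m) {σ : ℂ} (hσ : ¬ -m < σ.re) :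
    resolventRKC hL K h σ = 0 := by
  rw [resolventRKC, dif_neg hσ]

/-- `resolventRKC σ` commutes with multiplication by `i`. [folklore] -/
theorem resolventRKC_I_smul (hL : 0 < L) (K : Esp L hL →L[ℝ] W L) (h : GardingDataKC L hL d V K D₀ D₁ V₀ c m) (σ : ℂ) (G : Wc L) :
    resolventRKC hL K h σ ((Complex.I : ℂ) • G) = (Complex.I : ℂ) • resolventRKC hL K h σ G := by
  by_cases hσ : -m < σ.re
  · rw [resolventRKC_apply hL K h hσ, resolventRKC_apply hL K h hσ]
    have hrot : toPair L ((Complex.I : ℂ) • G) = WithLp.toLp 2 (-(toPair L G).snd, (toPair L G).fst) :=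
      WithLp.ofLp_injective 2 (Prod.ext (toPair_I_smul G).1 (toPair_I_smul G).2)
    rw [hrot, pairOpKC_rot hL K h σ hσ]
    set Q := pairOpKC hL K h σ hσ (toPair L G)
    have hι : ιpair hL (WithLp.toLp 2 (-Q.snd, Q.fst)) = WithLp.toLp 2 (-(ιpair hL Q).snd, (ιpair hL Q).fst) := by
      obtain ⟨h1, h2⟩ := ιpair_fst_snd hL Q
      obtain ⟨h1', h2'⟩ := ιpair_fst_snd hL (WithLp.toLp 2 (-Q.snd, Q.fst) : WithLp 2 (Esp L hL × Esp L hL))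
      refine WithLp.ofLp_injective 2 (Prod.ext ?_ ?_)
      · show (ιpair hL (WithLp.toLp 2 (-Q.snd, Q.fst))).fst = -(ιpair hL Q).snd
        rw [h1', h2]; exact map_neg (ιE hL) Q.snd
      · show (ιpair hL (WithLp.toLp 2 (-Q.snd, Q.fst))).snd = (ιpair hL Q).fst
        rw [h2', h1]; rfl
    rw [hι, ofPair_rot]
  · rw [resolventRKC_of_not hL K h hσ]; simp

/-- **THE PERTURBED RESOLVENT** `R_K(σ) : L²_w(ℂ) →L[ℂ] L²_w(ℂ)` of `(−∂² + d∂ + V) + K` (`ℂ`-linear; `0` outside `Re σ > −m`). [folklore] -/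
def resolventKC (hL : 0 < L) (K : Esp L hL →L[ℝ] W L) (h : GardingDataKC L hL d V K D₀ D₁ V₀ c m) (σ : ℂ) : Wc L →L[ℂ] Wc L :=
  toComplexCLM (resolventRKC hL K h σ) (resolventRKC_I_smul hL K h σ)

/-- `resolventKC σ` acts as `resolventRKC σ`. [folklore] -/
theorem resolventKC_apply (hL : 0 < L) (K : Esp L hL →L[ℝ] W L) (h : GardingDataKC L hL d V K D₀ D₁ V₀ c m) (σ : ℂ) (G : Wc L) :
    resolventKC hL K h σ G = resolventRKC hL K h σ G := rfl

/-- **Weak meaning of the perturbed resolvent** (`Re σ > −m`): `resolventKC σ G = ofPair (ιE p_R, ιE p_I)` with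
`(p_R, p_I) = pairOpKC σ (Re G, Im G)`, `Re/Im R_K(σ)G = prim (der p_•)` a.e., and the profiles solve the perturbed pair system with data
`(Re G, Im G)`. [folklore] -/
theorem resolventKC_weak (hL : 0 < L) (K : Esp L hL →L[ℝ] W L) (h : GardingDataKC L hL d V K D₀ D₁ V₀ c m) {σ : ℂ} (hσ : -m < σ.re)
    (G : Wc L) :
    resolventKC hL K h σ G = ofPair L (ιpair hL (pairOpKC hL K h σ hσ (toPair L G))) ∧
      (((reW L (resolventKC hL K h σ G) : W L) : ℝ → ℝ) =ᵐ[volume] prim (der (pairOpKC hL K h σ hσ (toPair L G)).fst)) ∧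
      (((imW L (resolventKC hL K h σ G) : W L) : ℝ → ℝ) =ᵐ[volume] prim (der (pairOpKC hL K h σ hσ (toPair L G)).snd)) ∧
      ∀ v v₁ : ℝ → ℝ, IsCompactTest v v₁ →
        linForm L d (fun ξ => V ξ + σ.re) (prim (der (pairOpKC hL K h σ hσ (toPair L G)).fst)) (der (pairOpKC hL K h σ hσ (toPair L G)).fst) v v₁
              + (∫ y, (L ^ 2 + y ^ 2) * (((K (pairOpKC hL K h σ hσ (toPair L G)).fst : W L) : ℝ → ℝ) y * v y))
              - σ.im * ∫ y, (L ^ 2 + y ^ 2) * (prim (der (pairOpKC hL K h σ hσ (toPair L G)).snd) y * v y) =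
            ∫ y, (L ^ 2 + y ^ 2) * (((reW L G : W L) : ℝ → ℝ) y * v y) ∧
          linForm L d (fun ξ => V ξ + σ.re) (prim (der (pairOpKC hL K h σ hσ (toPair L G)).snd)) (der (pairOpKC hL K h σ hσ (toPair L G)).snd) v v₁
              + (∫ y, (L ^ 2 + y ^ 2) * (((K (pairOpKC hL K h σ hσ (toPair L G)).snd : W L) : ℝ → ℝ) y * v y))
              + σ.im * ∫ y, (L ^ 2 + y ^ 2) * (prim (der (pairOpKC hL K h σ hσ (toPair L G)).fst) y * v y) =
            ∫ y, (L ^ 2 + y ^ 2) * (((imW L G : W L) : ℝ → ℝ) y * v y) := by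
  have happ : resolventKC hL K h σ G = ofPair L (ιpair hL (pairOpKC hL K h σ hσ (toPair L G))) := by
    rw [resolventKC_apply, resolventRKC_apply hL K h hσ]
  set Q := pairOpKC hL K h σ hσ (toPair L G) with hQ
  have hpair : toPair L (resolventKC hL K h σ G) = ιpair hL Q := by rw [happ, toPair_ofPair]
  obtain ⟨hc1, hc2⟩ := toPair_fst_snd (resolventKC hL K h σ G)
  obtain ⟨hi1, hi2⟩ := ιpair_fst_snd hL Q
  refine ⟨happ, ?_, ?_, fun v v₁ hv => (pairOpKC_spec hL K h σ hσ).1 (toPair L G) v v₁ hv⟩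
  · rw [← hc1, hpair, hi1]; exact ιE_ae hL Q.fst
  · rw [← hc2, hpair, hi2]; exact ιE_ae hL Q.snd

/-- **Norm bound**: `‖resolventKC σ G‖ ≤ (8/κ(σ))‖G‖` on the half-plane. [folklore] -/
theorem norm_resolventKC_le (hL : 0 < L) (K : Esp L hL →L[ℝ] W L) (h : GardingDataKC L hL d V K D₀ D₁ V₀ c m) {σ : ℂ} (hσ : -m < σ.re)
    (G : Wc L) : ‖resolventKC hL K h σ G‖ ≤ 8 / min c (4 * (m + σ.re)) * ‖G‖ := by
  obtain ⟨happ, -, -, -⟩ := resolventKC_weak hL K h hσ G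
  rw [happ, norm_ofPair]
  have h1 := norm_ιpair_le hL (pairOpKC hL K h σ hσ (toPair L G))
  have h2 := (pairOpKC_spec hL K h σ hσ).2 (toPair L G)
  rw [norm_toPair] at h2
  calc ‖ιpair hL (pairOpKC hL K h σ hσ (toPair L G))‖ ≤ 2 * ‖pairOpKC hL K h σ hσ (toPair L G)‖ := h1
    _ ≤ 2 * (4 / min c (4 * (m + σ.re)) * ‖G‖) := by gcongr
    _ = 8 / min c (4 * (m + σ.re)) * ‖G‖ := by ring

end SheetRPerturbedResolventC
end Summit.NavierStokesRegularity.OSWSelfSimilar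

end
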